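import Summits.CriticalPhenomena.PercolationContinuityZ3.Theorems.Transplant.SkelFrmBChoiceReadings2
import Summits.CriticalPhenomena.PercolationContinuityZ3.Theorems.Transplant.SkelFrmBChoiceArrival
import Summits.CriticalPhenomena.PercolationContinuityZ3.Theorems.Transplant.SkelPhiNegReachReadBK
import HarnessLib

/-!
# N2 (frames-only node `SamePDropOfSkeletonFrm₁`, OPEN) — (ζ″) ledger under J23/(R-44): THE x-CORRIDOR's ARRIVAL BOX AND ITS ALONG READING ROW AT THE
# WIDER WINDOWS (`q := kgq qxQ4 = 98·n_L`, `W := kgW WxQ4 = 20·sL + 42`; `BSlot.small3 = (76·s₀, 19·s₁)`) — successor of SkelFrmBChoiceArrival (p357473):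
# `arrLoQ3/arrHiQ3` (= `kgLastLo/Hi N` by `rfl`), `arr_bounds3` (`|arrLo₁|, |arrHi₁| ≤ 29·sL`, the along centring), **`hLl_Q3`** (`20r₀ − b₀ + 1 ≤ rdLo₀ ∧
# 5r₀ ≤ rdLo₀ ∧ rdHi₀ ≤ 20r₀ + b₀ − 1 ∧ rdHi₀ ≤ 22r₀` at `b₀ = small3 0 = 76·s₀`; shear coupling `≤ 30·s₀`, margin ≈ 44·s₀), `hrow_Q3` (p3's root rows);
# the generic §1 lemmas (`shear_terms_le`, `two_mul_ediv_two`, `arr_rows_aux`) are imported from the landed file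

* `arrLoQ3/arrHiQ3`, `arrQ3_eq`, `arr_bounds3`, **`hLl_Q3`**, `hrow_Q3`.
NON-VACUITY: value rows at the closed tuple.
builds on p205010 (kernel theorem, internal audit signed; external expert review pending) — nothing in this file uses p205010; NOTHING is claimed about the open
node `SamePDropOfSkeletonFrm₁`.
Lane `prim-bschramm`, seat `prim-bschramm-stmt` (gen 21); helper file (`--supports stmt-CriticalPhenomena-4575 --as helper`).
[cite: KozmaNitzan2024, §4 Lemma 12 (pp. 23–25: the corridor's arrival box)] [cite: MartineauTassion2017, §4.3 Lemma 4.2]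
-/

open scoped Classical

noncomputable section

namespace Summit.CriticalPhenomena.PercolationContinuityZ3.Theorems.Transplant

namespace PlanarSkeletonFrm

namespace NegB

open Literature.Probability.Percolation Literature.Probability.LatticeModels SimpleGraph
open SkelConc (Consts)
open Skelφ (shearUnit kgSL kgZ₁ kgM₁ kgM₂ kgWm₂ kgWp₂ kgE₁ kgA₁ kgX kgX₂ kgCtr2 kgHw2 kgFar rdLo rdHi KGRows)
open TwoAxis.Para (modulus)
open Neg

/-! ## §1 Two shear-term bounds -/

section Arrival

variable (κ : Consts) {V : Type} [DecidableEq V] [Countable V] {G : SimpleGraph V} [G.LocallyFinite] (Φ : PlanarSkeletonFrm G) (t : V) (p : unitInterval)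
  (D : Skelφ.StepI.DataNS V) (g f mk : ℕ)

/-- The arrival box's lower corner at the tuple of record (`= KGRows.kgLastLo` at `ρ := 0`, by `rfl`). [this work] -/
def arrLoQ3 : Site 2 :=
  ![(((kgNv0 κ Φ t p D g f mk (qxQ4 κ Φ t p D g f) (WxQ4 κ Φ t p D g f) : ℕ) : ℤ) + 1) * (nL κ Φ t p D g f : ℤ) +
      kgX (nL κ Φ t p D g f) (ℓL κ Φ t p D g f) (hL κ Φ t p D g f) (vL κ Φ t p D g f) (kgR κ Φ t p D mk) 0 (kgq κ Φ t p D g f (qxQ4 κ Φ t p D g f))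
        (kgW κ Φ t p D g f (WxQ4 κ Φ t p D g f)) (kgNv0 κ Φ t p D g f mk (qxQ4 κ Φ t p D g f) (WxQ4 κ Φ t p D g f)) - ((nL κ Φ t p D g f : ℤ) + ((0 : ℕ) : ℤ) - 1),
    (kgCtr2 (nL κ Φ t p D g f) (ℓL κ Φ t p D g f) (hL κ Φ t p D g f) (kgR κ Φ t p D mk) 0 (kgW κ Φ t p D g f (WxQ4 κ Φ t p D g f))
        (kgNv0 κ Φ t p D g f mk (qxQ4 κ Φ t p D g f) (WxQ4 κ Φ t p D g f)) -
      kgHw2 (nL κ Φ t p D g f) (ℓL κ Φ t p D g f) (hL κ Φ t p D g f) (vL κ Φ t p D g f) (kgR κ Φ t p D mk) 0 (kgq κ Φ t p D g f (qxQ4 κ Φ t p D g f))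
        (kgW κ Φ t p D g f (WxQ4 κ Φ t p D g f)) (kgNv0 κ Φ t p D g f mk (qxQ4 κ Φ t p D g f) (WxQ4 κ Φ t p D g f)) + 1) / 2]

/-- The arrival box's upper corner at the tuple of record (`= KGRows.kgLastHi`, by `rfl`). [this work] -/
def arrHiQ3 : Site 2 :=
  ![(((kgNv0 κ Φ t p D g f mk (qxQ4 κ Φ t p D g f) (WxQ4 κ Φ t p D g f) : ℕ) : ℤ) + 1) * (nL κ Φ t p D g f : ℤ) +
      kgX (nL κ Φ t p D g f) (ℓL κ Φ t p D g f) (hL κ Φ t p D g f) (vL κ Φ t p D g f) (kgR κ Φ t p D mk) 0 (kgq κ Φ t p D g f (qxQ4 κ Φ t p D g f))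
        (kgW κ Φ t p D g f (WxQ4 κ Φ t p D g f)) (kgNv0 κ Φ t p D g f mk (qxQ4 κ Φ t p D g f) (WxQ4 κ Φ t p D g f)),
    (kgCtr2 (nL κ Φ t p D g f) (ℓL κ Φ t p D g f) (hL κ Φ t p D g f) (kgR κ Φ t p D mk) 0 (kgW κ Φ t p D g f (WxQ4 κ Φ t p D g f))
        (kgNv0 κ Φ t p D g f mk (qxQ4 κ Φ t p D g f) (WxQ4 κ Φ t p D g f)) +
      kgHw2 (nL κ Φ t p D g f) (ℓL κ Φ t p D g f) (hL κ Φ t p D g f) (vL κ Φ t p D g f) (kgR κ Φ t p D mk) 0 (kgq κ Φ t p D g f (qxQ4 κ Φ t p D g f))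
        (kgW κ Φ t p D g f (WxQ4 κ Φ t p D g f)) (kgNv0 κ Φ t p D g f mk (qxQ4 κ Φ t p D g f) (WxQ4 κ Φ t p D g f))) / 2]

/-- `[arrLoQ3, arrHiQ3]` IS p5's `[kgLastLo, kgLastHi]` at the rows of record (`rfl`). [folklore] -/
theorem arrQ3_eq (hN : EqNumL κ Φ t p D g f) (hg : gFloorKG κ Φ t p D mk ≤ g) :
    arrLoQ3 κ Φ t p D g f mk = (kgRows0_of κ Φ t p D g f mk (qxQ4 κ Φ t p D g f) (WxQ4 κ Φ t p D g f) hN hg).kgLastLo (kgNv0 κ Φ t p D g f mk (qxQ4 κ Φ t p D g f) (WxQ4 κ Φ t p D g f)) ∧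
    arrHiQ3 κ Φ t p D g f mk = (kgRows0_of κ Φ t p D g f mk (qxQ4 κ Φ t p D g f) (WxQ4 κ Φ t p D g f) hN hg).kgLastHi (kgNv0 κ Φ t p D g f mk (qxQ4 κ Φ t p D g f) (WxQ4 κ Φ t p D g f)) :=
  ⟨rfl, rfl⟩

/-- **THE ARRIVAL BOX'S COORDINATES**: rows `arrHi₁ = A₁ + (m₁+m₂+2)R′`, `arrLo₁ = A₁ + (m₁+1)R′ − E₁ − (m₂+1)R′`, hence `|arrLo₁|, |arrHi₁| ≤ Z₁ ≤ 29·sL`; along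
`2·arrLo₀ ≥ 40K·n − 3n − 8R′ + 1` and `2·arrHi₀ ≤ 40K·n + 3n + 8R′ − 1` (centring). [this work] -/
theorem arr_bounds3 (hN : EqNumL κ Φ t p D g f) (hg : gFloorKG κ Φ t p D mk ≤ g) (hg2 : 40 * Neg.K κ * KS0.R'0 κ Φ t p D mk ≤ g) :
    |arrLoQ3 κ Φ t p D g f mk 1| ≤ 29 * kgSL (nL κ Φ t p D g f) (ℓL κ Φ t p D g f) (hL κ Φ t p D g f) ∧
    |arrHiQ3 κ Φ t p D g f mk 1| ≤ 29 * kgSL (nL κ Φ t p D g f) (ℓL κ Φ t p D g f) (hL κ Φ t p D g f) ∧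
    40 * (Neg.K κ : ℤ) * (nL κ Φ t p D g f : ℤ) - 3 * (nL κ Φ t p D g f : ℤ) - 8 * ((KS0.R'0 κ Φ t p D mk : ℕ) : ℤ) + 1 ≤ 2 * arrLoQ3 κ Φ t p D g f mk 0 ∧
    2 * arrHiQ3 κ Φ t p D g f mk 0 ≤ 40 * (Neg.K κ : ℤ) * (nL κ Φ t p D g f : ℤ) + 3 * (nL κ Φ t p D g f : ℤ) + 8 * ((KS0.R'0 κ Φ t p D mk : ℕ) : ℤ) - 1 := by
  have H := kgRows0_of κ Φ t p D g f mk (qxQ4 κ Φ t p D g f) (WxQ4 κ Φ t p D g f) hN hg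
  have hZ₁ := Z₁Q4_le κ Φ t p D g f mk hN hg hg2
  set N := kgNv0 κ Φ t p D g f mk (qxQ4 κ Φ t p D g f) (WxQ4 κ Φ t p D g f) with hNdef
  have hsum : ((kgWm₂ (nL κ Φ t p D g f) (ℓL κ Φ t p D g f) (hL κ Φ t p D g f) (kgR κ Φ t p D mk) 0 (kgW κ Φ t p D g f (WxQ4 κ Φ t p D g f)) N : ℕ) : ℤ) +
      (kgWp₂ (nL κ Φ t p D g f) (ℓL κ Φ t p D g f) (hL κ Φ t p D g f) (kgR κ Φ t p D mk) 0 (kgW κ Φ t p D g f (WxQ4 κ Φ t p D g f)) N : ℕ) =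
      (kgE₁ (nL κ Φ t p D g f) (ℓL κ Φ t p D g f) (hL κ Φ t p D g f) (kgR κ Φ t p D mk) 0 (kgW κ Φ t p D g f (WxQ4 κ Φ t p D g f)) N : ℕ) := by
    exact_mod_cast Skelφ.kgWm₂_add_kgWp₂ (n := nL κ Φ t p D g f) (ℓ := ℓL κ Φ t p D g f) (hs := hL κ Φ t p D g f) (R' := kgR κ Φ t p D mk) (ρ := 0)
      (W := kgW κ Φ t p D g f (WxQ4 κ Φ t p D g f)) N
  -- the centring
  have hspec := H.kgN_spec (kgFar_zero_le_kgTgt0_4 κ Φ t p D g f mk hN hg)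
  have hNv : Skelφ.kgN (nL κ Φ t p D g f) (ℓL κ Φ t p D g f) (hL κ Φ t p D g f) (vL κ Φ t p D g f) (kgR κ Φ t p D mk) 0
      (kgq κ Φ t p D g f (qxQ4 κ Φ t p D g f)) (kgW κ Φ t p D g f (WxQ4 κ Φ t p D g f)) (kgTgt0 κ Φ t p D g f mk) = N := rfl
  rw [hNv] at hspec
  obtain ⟨hfar, htgt⟩ := hspec
  have hv := hN.v_le
  have hva : (0 : ℤ) ≤ |vL κ Φ t p D g f| := abs_nonneg _
  have hn1 : (1 : ℤ) ≤ nL κ Φ t p D g f := by exact_mod_cast (one_le_of_eqNumL κ Φ t p D g f hN).1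
  -- tgt0 = pitch + (n-1)/2 + (n + Δ₀)/2, two-sided integer bounds
  have ht2 : 40 * (Neg.K κ : ℤ) * (nL κ Φ t p D g f : ℤ) + 2 * (nL κ Φ t p D g f : ℤ) +
      (8 * ((KS0.R'0 κ Φ t p D mk : ℕ) : ℤ) + |vL κ Φ t p D g f|) - 3 ≤ 2 * kgTgt0 κ Φ t p D g f mk ∧
      2 * kgTgt0 κ Φ t p D g f mk ≤ 40 * (Neg.K κ : ℤ) * (nL κ Φ t p D g f : ℤ) + 2 * (nL κ Φ t p D g f : ℤ) +
      (8 * ((KS0.R'0 κ Φ t p D mk : ℕ) : ℤ) + |vL κ Φ t p D g f|) - 1 := by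
    have eT : kgTgt0 κ Φ t p D g f mk = pitch κ Φ t p D g f + ((nL κ Φ t p D g f : ℤ) - 1) / 2 +
        ((nL κ Φ t p D g f : ℤ) + Skelφ.kgΔ (vL κ Φ t p D g f) (kgR κ Φ t p D mk) 0) / 2 := rfl
    have eP : pitch κ Φ t p D g f = 20 * (Neg.K κ : ℤ) * (nL κ Φ t p D g f : ℤ) := rfl
    have eΔ : Skelφ.kgΔ (vL κ Φ t p D g f) (kgR κ Φ t p D mk) 0 = 8 * ((KS0.R'0 κ Φ t p D mk : ℕ) : ℤ) + 7 * ((0 : ℕ) : ℤ) + |vL κ Φ t p D g f| := rfl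
    have b1 := two_mul_ediv_two ((nL κ Φ t p D g f : ℤ) - 1)
    have b2 := two_mul_ediv_two ((nL κ Φ t p D g f : ℤ) + Skelφ.kgΔ (vL κ Φ t p D g f) (kgR κ Φ t p D mk) 0)
    rw [eΔ] at b2
    rw [eT, eP, eΔ]
    push_cast at b2 ⊢
    constructor <;> linarith
  have e0l : arrLoQ3 κ Φ t p D g f mk 0 = ((N : ℤ) + 1) * (nL κ Φ t p D g f : ℤ) +
      kgX (nL κ Φ t p D g f) (ℓL κ Φ t p D g f) (hL κ Φ t p D g f) (vL κ Φ t p D g f) (kgR κ Φ t p D mk) 0 (kgq κ Φ t p D g f (qxQ4 κ Φ t p D g f))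
        (kgW κ Φ t p D g f (WxQ4 κ Φ t p D g f)) N - ((nL κ Φ t p D g f : ℤ) + ((0 : ℕ) : ℤ) - 1) := rfl
  have e0h : arrHiQ3 κ Φ t p D g f mk 0 = ((N : ℤ) + 1) * (nL κ Φ t p D g f : ℤ) +
      kgX (nL κ Φ t p D g f) (ℓL κ Φ t p D g f) (hL κ Φ t p D g f) (vL κ Φ t p D g f) (kgR κ Φ t p D mk) 0 (kgq κ Φ t p D g f (qxQ4 κ Φ t p D g f))
        (kgW κ Φ t p D g f (WxQ4 κ Φ t p D g f)) N := rfl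
  have e1l : arrLoQ3 κ Φ t p D g f mk 1 = (kgCtr2 (nL κ Φ t p D g f) (ℓL κ Φ t p D g f) (hL κ Φ t p D g f) (kgR κ Φ t p D mk) 0 (kgW κ Φ t p D g f (WxQ4 κ Φ t p D g f)) N -
      kgHw2 (nL κ Φ t p D g f) (ℓL κ Φ t p D g f) (hL κ Φ t p D g f) (vL κ Φ t p D g f) (kgR κ Φ t p D mk) 0 (kgq κ Φ t p D g f (qxQ4 κ Φ t p D g f))
        (kgW κ Φ t p D g f (WxQ4 κ Φ t p D g f)) N + 1) / 2 := rfl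
  have e1h : arrHiQ3 κ Φ t p D g f mk 1 = (kgCtr2 (nL κ Φ t p D g f) (ℓL κ Φ t p D g f) (hL κ Φ t p D g f) (kgR κ Φ t p D mk) 0 (kgW κ Φ t p D g f (WxQ4 κ Φ t p D g f)) N +
      kgHw2 (nL κ Φ t p D g f) (ℓL κ Φ t p D g f) (hL κ Φ t p D g f) (vL κ Φ t p D g f) (kgR κ Φ t p D mk) 0 (kgq κ Φ t p D g f (qxQ4 κ Φ t p D g f))
        (kgW κ Φ t p D g f (WxQ4 κ Φ t p D g f)) N) / 2 := rfl
  unfold Skelφ.kgFar at hfar htgt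
  have hR0 : (0 : ℤ) ≤ ((kgR κ Φ t p D mk : ℕ) : ℤ) := by positivity
  have hm10 : (0 : ℤ) ≤ ((kgM₁ (nL κ Φ t p D g f) (ℓL κ Φ t p D g f) (hL κ Φ t p D g f) (kgR κ Φ t p D mk) 0 (kgW κ Φ t p D g f (WxQ4 κ Φ t p D g f)) N : ℕ) : ℤ) := by positivity
  have hm20 : (0 : ℤ) ≤ ((kgM₂ (nL κ Φ t p D g f) (ℓL κ Φ t p D g f) (hL κ Φ t p D g f) (vL κ Φ t p D g f) (kgR κ Φ t p D mk) 0
      (kgq κ Φ t p D g f (qxQ4 κ Φ t p D g f)) (kgW κ Φ t p D g f (WxQ4 κ Φ t p D g f)) N : ℕ) : ℤ) := by positivity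
  have hA0' : (0 : ℤ) ≤ ((kgA₁ (nL κ Φ t p D g f) (ℓL κ Φ t p D g f) (hL κ Φ t p D g f) (kgR κ Φ t p D mk) (kgW κ Φ t p D g f (WxQ4 κ Φ t p D g f)) N : ℕ) : ℤ) := by positivity
  have hWm0 : (0 : ℤ) ≤ ((kgWm₂ (nL κ Φ t p D g f) (ℓL κ Φ t p D g f) (hL κ Φ t p D g f) (kgR κ Φ t p D mk) 0 (kgW κ Φ t p D g f (WxQ4 κ Φ t p D g f)) N : ℕ) : ℤ) := by positivity
  have hP0 : (0 : ℤ) ≤ ((nL κ Φ t p D g f * ℓL κ Φ t p D g f / shearUnit (nL κ Φ t p D g f) (hL κ Φ t p D g f) + 1 : ℕ) : ℤ) := by positivity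
  have hL0 : (0 : ℤ) ≤ ((3 * (nL κ Φ t p D g f * ℓL κ Φ t p D g f) / shearUnit (nL κ Φ t p D g f) (hL κ Φ t p D g f) + 1 : ℕ) : ℤ) := by positivity
  -- twice the row corners, without divisions
  set C := kgCtr2 (nL κ Φ t p D g f) (ℓL κ Φ t p D g f) (hL κ Φ t p D g f) (kgR κ Φ t p D mk) 0 (kgW κ Φ t p D g f (WxQ4 κ Φ t p D g f)) N with hCdef
  set Hw := kgHw2 (nL κ Φ t p D g f) (ℓL κ Φ t p D g f) (hL κ Φ t p D g f) (vL κ Φ t p D g f) (kgR κ Φ t p D mk) 0 (kgq κ Φ t p D g f (qxQ4 κ Φ t p D g f))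
        (kgW κ Φ t p D g f (WxQ4 κ Φ t p D g f)) N with hHwdef
  set Z := kgZ₁ (nL κ Φ t p D g f) (ℓL κ Φ t p D g f) (hL κ Φ t p D g f) (kgR κ Φ t p D mk) 0 (kgW κ Φ t p D g f (WxQ4 κ Φ t p D g f)) N
      (kgM₁ (nL κ Φ t p D g f) (ℓL κ Φ t p D g f) (hL κ Φ t p D g f) (kgR κ Φ t p D mk) 0 (kgW κ Φ t p D g f (WxQ4 κ Φ t p D g f)) N)
      (kgWm₂ (nL κ Φ t p D g f) (ℓL κ Φ t p D g f) (hL κ Φ t p D g f) (kgR κ Φ t p D mk) 0 (kgW κ Φ t p D g f (WxQ4 κ Φ t p D g f)) N)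
      (kgWp₂ (nL κ Φ t p D g f) (ℓL κ Φ t p D g f) (hL κ Φ t p D g f) (kgR κ Φ t p D mk) 0 (kgW κ Φ t p D g f (WxQ4 κ Φ t p D g f)) N)
      (kgM₂ (nL κ Φ t p D g f) (ℓL κ Φ t p D g f) (hL κ Φ t p D g f) (vL κ Φ t p D g f) (kgR κ Φ t p D mk) 0
        (kgq κ Φ t p D g f (qxQ4 κ Φ t p D g f)) (kgW κ Φ t p D g f (WxQ4 κ Φ t p D g f)) N) with hZdef
  have hCH1 : -(2 * Z) ≤ C - Hw ∧ C - Hw ≤ 2 * Z ∧ 0 ≤ C + Hw ∧ C + Hw ≤ 2 * Z := by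
    have h := arr_rows_aux (A := ((kgA₁ (nL κ Φ t p D g f) (ℓL κ Φ t p D g f) (hL κ Φ t p D g f) (kgR κ Φ t p D mk) (kgW κ Φ t p D g f (WxQ4 κ Φ t p D g f)) N : ℕ) : ℤ))
      (E := ((kgE₁ (nL κ Φ t p D g f) (ℓL κ Φ t p D g f) (hL κ Φ t p D g f) (kgR κ Φ t p D mk) 0 (kgW κ Φ t p D g f (WxQ4 κ Φ t p D g f)) N : ℕ) : ℤ))
      (P := ((nL κ Φ t p D g f * ℓL κ Φ t p D g f / shearUnit (nL κ Φ t p D g f) (hL κ Φ t p D g f) + 1 : ℕ) : ℤ))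
      (L := ((3 * (nL κ Φ t p D g f * ℓL κ Φ t p D g f) / shearUnit (nL κ Φ t p D g f) (hL κ Φ t p D g f) + 1 : ℕ) : ℤ))
      (R := ((kgR κ Φ t p D mk : ℕ) : ℤ)) (ρ := ((0 : ℕ) : ℤ))
      (Wm := ((kgWm₂ (nL κ Φ t p D g f) (ℓL κ Φ t p D g f) (hL κ Φ t p D g f) (kgR κ Φ t p D mk) 0 (kgW κ Φ t p D g f (WxQ4 κ Φ t p D g f)) N : ℕ) : ℤ))
      (Wp := ((kgWp₂ (nL κ Φ t p D g f) (ℓL κ Φ t p D g f) (hL κ Φ t p D g f) (kgR κ Φ t p D mk) 0 (kgW κ Φ t p D g f (WxQ4 κ Φ t p D g f)) N : ℕ) : ℤ))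
      (m₁ := ((kgM₁ (nL κ Φ t p D g f) (ℓL κ Φ t p D g f) (hL κ Φ t p D g f) (kgR κ Φ t p D mk) 0 (kgW κ Φ t p D g f (WxQ4 κ Φ t p D g f)) N : ℕ) : ℤ))
      (m₂ := ((kgM₂ (nL κ Φ t p D g f) (ℓL κ Φ t p D g f) (hL κ Φ t p D g f) (vL κ Φ t p D g f) (kgR κ Φ t p D mk) 0
        (kgq κ Φ t p D g f (qxQ4 κ Φ t p D g f)) (kgW κ Φ t p D g f (WxQ4 κ Φ t p D g f)) N : ℕ) : ℤ))
      hA0' hP0 hL0 hR0 le_rfl hWm0 (by positivity) hm10 hm20 hsum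
    exact h
  obtain ⟨c1, c2, c3, c4⟩ := hCH1
  have dl1 := Int.ediv_mul_le (C - Hw + 1) (b := 2) (by norm_num)
  have dl2 := Int.lt_ediv_add_one_mul_self (C - Hw + 1) (b := 2) (by norm_num)
  have dh1 := Int.ediv_mul_le (C + Hw) (b := 2) (by norm_num)
  have dh2 := Int.lt_ediv_add_one_mul_self (C + Hw) (b := 2) (by norm_num)
  refine ⟨?_, ?_, ?_, ?_⟩
  · rw [e1l, abs_le]; constructor <;> omega
  · rw [e1h, abs_le]; constructor <;> omega
  · rw [e0l]
    have eΔ' : Skelφ.kgΔ (vL κ Φ t p D g f) (kgR κ Φ t p D mk) 0 = 8 * ((KS0.R'0 κ Φ t p D mk : ℕ) : ℤ) + 7 * ((0 : ℕ) : ℤ) + |vL κ Φ t p D g f| := rfl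
    rw [eΔ'] at htgt
    have h1 := ht2.1
    push_cast at htgt h1 ⊢
    linarith
  · rw [e0h]
    have h2 := ht2.2
    linarith

/-- **THE ARRIVAL READING ROW, ALONG (`hLl` at `du.1 = 0`)**: `20r₀ − b₀ + 1 ≤ rdLo₀ ∧ 5r₀ ≤ rdLo₀ ∧ rdHi₀ ≤ 20r₀ + b₀ − 1 ∧ rdHi₀ ≤ 22r₀` for the arrival box
`[arrLoQ3, arrHiQ3]` and the window of record `b₀ = small3 0 = 76·s₀`. [this work] -/
theorem hLl_Q3 (hN : EqNumL κ Φ t p D g f) (hg : gFloorKG κ Φ t p D mk ≤ g) (hg2 : 40 * Neg.K κ * KS0.R'0 κ Φ t p D mk ≤ g) :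
    20 * (((fcellsA κ Φ t p D g f).r 0 : ℕ) : ℤ) - ((BSlot.small3 κ Φ t p D g f 0 : ℕ) : ℤ) + 1 ≤
        rdLo (Aof κ) (nL κ Φ t p D g f) (hL κ Φ t p D g f) (vL κ Φ t p D g f) (vβL κ Φ t p D g f) (prFA κ Φ t p D g f).c₀ (prFA κ Φ t p D g f).c₁
          (prFA κ Φ t p D g f).D (arrLoQ3 κ Φ t p D g f mk) (arrHiQ3 κ Φ t p D g f mk) 0 ∧
      5 * (((fcellsA κ Φ t p D g f).r 0 : ℕ) : ℤ) ≤
        rdLo (Aof κ) (nL κ Φ t p D g f) (hL κ Φ t p D g f) (vL κ Φ t p D g f) (vβL κ Φ t p D g f) (prFA κ Φ t p D g f).c₀ (prFA κ Φ t p D g f).c₁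
          (prFA κ Φ t p D g f).D (arrLoQ3 κ Φ t p D g f mk) (arrHiQ3 κ Φ t p D g f mk) 0 ∧
      rdHi (Aof κ) (nL κ Φ t p D g f) (hL κ Φ t p D g f) (vL κ Φ t p D g f) (vβL κ Φ t p D g f) (prFA κ Φ t p D g f).c₀ (prFA κ Φ t p D g f).c₁
          (prFA κ Φ t p D g f).D (arrLoQ3 κ Φ t p D g f mk) (arrHiQ3 κ Φ t p D g f mk) 0 ≤
        20 * (((fcellsA κ Φ t p D g f).r 0 : ℕ) : ℤ) + ((BSlot.small3 κ Φ t p D g f 0 : ℕ) : ℤ) - 1 ∧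
      rdHi (Aof κ) (nL κ Φ t p D g f) (hL κ Φ t p D g f) (vL κ Φ t p D g f) (vβL κ Φ t p D g f) (prFA κ Φ t p D g f).c₀ (prFA κ Φ t p D g f).c₁
          (prFA κ Φ t p D g f).D (arrLoQ3 κ Φ t p D g f mk) (arrHiQ3 κ Φ t p D g f mk) 0 ≤ 22 * (((fcellsA κ Φ t p D g f).r 0 : ℕ) : ℤ) := by
  obtain ⟨hsc0, -, hn1, hA0, hDp, hm, hc₀, -, hkq, hr40⟩ := hsc_Q κ Φ t p D g f hN
  obtain ⟨hl1, hh1, hlo0, hhi0⟩ := arr_bounds3 κ Φ t p D g f mk hN hg hg2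
  obtain ⟨hn40, hs40, hbig, hR1, hK, h8⟩ := valsQ_floor κ Φ t p D g f mk hN hg hg2
  have hUs := UsL_le_modulus κ Φ t p D g f hN
  have hv := hN.v_le
  have hva : (0 : ℤ) ≤ |vL κ Φ t p D g f| := abs_nonneg _
  have hKq : (Neg.K κ : ℤ) = 40 * ((Neg.Kq κ : ℕ) : ℤ) := by exact_mod_cast Neg.K_eq κ
  have hr0 : (((fcellsA κ Φ t p D g f).r 0 : ℕ) : ℤ) = (Neg.K κ : ℤ) * (((fcellsA κ Φ t p D g f).s 0 : ℕ) : ℤ) := by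
    rw [PCells2.r_eq]; rw [show ((fcellsA κ Φ t p D g f).K : ℤ) = Neg.K κ by exact_mod_cast (fcellsA_K κ Φ t p D g f).1]
  have hb0 : ((BSlot.small3 κ Φ t p D g f 0 : ℕ) : ℤ) = 76 * (((fcellsA κ Φ t p D g f).s 0 : ℕ) : ℤ) := by rw [(small3_eq κ Φ t p D g f).1]; push_cast; ring
  have hU1 : (1 : ℤ) ≤ ((shearUnit (nL κ Φ t p D g f) (hL κ Φ t p D g f) : ℕ) : ℤ) := by
    have := Skelφ.shearUnit_pos (one_le_of_eqNumL κ Φ t p D g f hN).1 (hL κ Φ t p D g f); exact this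
  obtain ⟨hMp, hMm⟩ := shear_terms_le (v := vL κ Φ t p D g f) hU1 hl1 hh1
  set Δ := modulus (nL κ Φ t p D g f) (hL κ Φ t p D g f) (vL κ Φ t p D g f) (vβL κ Φ t p D g f) with hΔ
  set U := ((shearUnit (nL κ Φ t p D g f) (hL κ Φ t p D g f) : ℕ) : ℤ) with hUdef
  set s := kgSL (nL κ Φ t p D g f) (ℓL κ Φ t p D g f) (hL κ Φ t p D g f) with hsdef
  set n := (nL κ Φ t p D g f : ℤ) with hndef
  set s0 := (((fcellsA κ Φ t p D g f).s 0 : ℕ) : ℤ) with hs0def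
  set R := ((KS0.R'0 κ Φ t p D mk : ℕ) : ℤ) with hRdef
  set va := |vL κ Φ t p D g f| with hvadef
  set kq := ((Neg.Kq κ : ℕ) : ℤ) with hkqdef
  set Mp := max (vL κ Φ t p D g f * (U * arrLoQ3 κ Φ t p D g f mk 1)) (vL κ Φ t p D g f * (U * arrHiQ3 κ Φ t p D g f mk 1 + U - 1)) with hMpdef'
  set Mm := min (vL κ Φ t p D g f * (U * arrLoQ3 κ Φ t p D g f mk 1)) (vL κ Φ t p D g f * (U * arrHiQ3 κ Φ t p D g f mk 1 + U - 1)) with hMmdef'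
  have hs0p : (1 : ℤ) ≤ s0 := by rw [hs0def]; exact_mod_cast (fcellsA κ Φ t p D g f).hs 0
  have hkq1 : (1 : ℤ) ≤ kq := by rw [hkqdef]; exact_mod_cast hkq
  -- the shear terms: |M±| ≤ 30 n Δ
  have hZU : U * (29 * s + 1) ≤ 30 * Δ := by nlinarith
  have hM1 : Mp ≤ 30 * n * Δ := by
    have : va * (U * (29 * s + 1)) ≤ n * (30 * Δ) := by
      calc va * (U * (29 * s + 1)) ≤ n * (U * (29 * s + 1)) := mul_le_mul_of_nonneg_right hv (by positivity)
        _ ≤ n * (30 * Δ) := mul_le_mul_of_nonneg_left hZU (by positivity)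
    linarith
  have hM2 : -(30 * n * Δ) ≤ Mm := by
    have : va * (U * (29 * s + 1)) ≤ n * (30 * Δ) := by
      calc va * (U * (29 * s + 1)) ≤ n * (U * (29 * s + 1)) := mul_le_mul_of_nonneg_right hv (by positivity)
        _ ≤ n * (30 * Δ) := mul_le_mul_of_nonneg_left hZU (by positivity)
    linarith
  have hΔ0 : 0 < Δ := hm
  have hsΔ : 0 ≤ s0 * Δ := by positivity
  -- products used below
  have hlo' : s0 * Δ * (40 * (40 * kq) * n - 3 * n - 8 * R + 1) ≤ 2 * (s0 * (Δ * arrLoQ3 κ Φ t p D g f mk 0)) := by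
    have := mul_le_mul_of_nonneg_left hlo0 hsΔ; rw [hKq] at this; linarith
  have hhi' : 2 * (s0 * (Δ * arrHiQ3 κ Φ t p D g f mk 0)) ≤ s0 * Δ * (40 * (40 * kq) * n + 3 * n + 8 * R - 1) := by
    have := mul_le_mul_of_nonneg_left hhi0 hsΔ; rw [hKq] at this; linarith
  have hMp' : s0 * Mp ≤ s0 * (30 * n * Δ) := mul_le_mul_of_nonneg_left hM1 (by linarith)
  have hMm' : -(s0 * (30 * n * Δ)) ≤ s0 * Mm := by have := mul_le_mul_of_nonneg_left hM2 (show (0 : ℤ) ≤ s0 by linarith); linarith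
  have hsΔn : 0 ≤ s0 * Δ * n := by positivity
  have hn0 : (0 : ℤ) ≤ n := by positivity
  have hΔn : Δ * n ≤ s0 * Δ * n := by
    calc Δ * n = 1 * (Δ * n) := by ring
      _ ≤ s0 * (Δ * n) := mul_le_mul_of_nonneg_right hs0p (by positivity)
      _ = s0 * Δ * n := by ring
  have hs0n : s0 * n ≤ s0 * Δ * n := by
    calc s0 * n = (s0 * n) * 1 := by ring
      _ ≤ (s0 * n) * Δ := mul_le_mul_of_nonneg_left (by linarith) (by positivity)
      _ = s0 * Δ * n := by ring
  have hRn : 8 * R + 7 ≤ n := h8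
  have hsΔR : s0 * Δ * (8 * R + 7) ≤ s0 * Δ * n := mul_le_mul_of_nonneg_left hRn hsΔ
  have hkq40 : (1 : ℤ) ≤ kq := hkq1
  have hsΔkn : s0 * Δ * n ≤ s0 * Δ * n * kq := by
    calc s0 * Δ * n = (s0 * Δ * n) * 1 := by ring
      _ ≤ (s0 * Δ * n) * kq := mul_le_mul_of_nonneg_left hkq40 hsΔn
  have hSpos : 0 < s0 * Δ * n := by positivity
  -- linearise: S := s0·Δ·n
  have d1 : s0 * Δ * (40 * (40 * kq) * n - 3 * n - 8 * R + 1) = 1600 * (kq * (s0 * Δ * n)) - 3 * (s0 * Δ * n) - (s0 * Δ * (8 * R + 7)) + 8 * (s0 * Δ) := by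
    ring
  have d1' : s0 * Δ * (40 * (40 * kq) * n + 3 * n + 8 * R - 1) = 1600 * (kq * (s0 * Δ * n)) + 3 * (s0 * Δ * n) + (s0 * Δ * (8 * R + 7)) - 8 * (s0 * Δ) := by
    ring
  have d4 : s0 * (30 * n * Δ) = 30 * (s0 * Δ * n) := by ring
  have dk : s0 * Δ * n * kq = kq * (s0 * Δ * n) := by ring
  rw [d1] at hlo'
  rw [d1'] at hhi'
  rw [d4] at hMp' hMm'
  rw [dk] at hsΔkn
  rw [hr0, hb0]
  rw [hKq]
  refine ⟨?_, ?_, ?_, ?_⟩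
  · refine Skelφ.rdLo_zero_geK (hn := hn1) (hA := hA0) (hD := hDp) (hm := hm) (hc₀ := hc₀) (hkq := hkq) (hsc0 := hsc0) ?_
    rw [hr0, hKq]
    have key : Δ * (n * (20 * (40 * kq * s0) - 76 * s0 + 1)) + s0 * n ≤ s0 * (Δ * arrLoQ3 κ Φ t p D g f mk 0 - Mp) := by
      have d2 : Δ * (n * (20 * (40 * kq * s0) - 76 * s0 + 1)) = 800 * (kq * (s0 * Δ * n)) - 76 * (s0 * Δ * n) + Δ * n := by ring
      have d3 : s0 * (Δ * arrLoQ3 κ Φ t p D g f mk 0 - Mp) = s0 * (Δ * arrLoQ3 κ Φ t p D g f mk 0) - s0 * Mp := by ring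
      rw [d2, d3]
      linarith
    have e1 : 40 * kq * Δ * (n * (20 * (40 * kq * s0) - 76 * s0 + 1)) + 40 * kq * s0 * n = 40 * kq * (Δ * (n * (20 * (40 * kq * s0) - 76 * s0 + 1)) + s0 * n) := by ring
    have e2 : 40 * kq * s0 * (Δ * arrLoQ3 κ Φ t p D g f mk 0 - Mp) = 40 * kq * (s0 * (Δ * arrLoQ3 κ Φ t p D g f mk 0 - Mp)) := by ring
    rw [e1, e2]
    exact mul_le_mul_of_nonneg_left key (by positivity)
  · refine Skelφ.rdLo_zero_geK (hn := hn1) (hA := hA0) (hD := hDp) (hm := hm) (hc₀ := hc₀) (hkq := hkq) (hsc0 := hsc0) ?_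
    rw [hr0, hKq]
    have key : Δ * (n * (5 * (40 * kq * s0))) + s0 * n ≤ s0 * (Δ * arrLoQ3 κ Φ t p D g f mk 0 - Mp) := by
      have d2 : Δ * (n * (5 * (40 * kq * s0))) = 200 * (kq * (s0 * Δ * n)) := by ring
      have d3 : s0 * (Δ * arrLoQ3 κ Φ t p D g f mk 0 - Mp) = s0 * (Δ * arrLoQ3 κ Φ t p D g f mk 0) - s0 * Mp := by ring
      rw [d2, d3]
      linarith
    have e1 : 40 * kq * Δ * (n * (5 * (40 * kq * s0))) + 40 * kq * s0 * n = 40 * kq * (Δ * (n * (5 * (40 * kq * s0))) + s0 * n) := by ring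
    have e2 : 40 * kq * s0 * (Δ * arrLoQ3 κ Φ t p D g f mk 0 - Mp) = 40 * kq * (s0 * (Δ * arrLoQ3 κ Φ t p D g f mk 0 - Mp)) := by ring
    rw [e1, e2]
    exact mul_le_mul_of_nonneg_left key (by positivity)
  · refine Skelφ.rdHi_zero_leK (hn := hn1) (hD := hDp) (hm := hm) (hc₀ := hc₀) (hkq := hkq) (hsc0 := hsc0) ?_
    rw [hr0, hKq]
    have key : s0 * (Δ * arrHiQ3 κ Φ t p D g f mk 0 - Mm) < Δ * (n * (20 * (40 * kq * s0) + 76 * s0 - 1)) := by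
      have d2 : Δ * (n * (20 * (40 * kq * s0) + 76 * s0 - 1)) = 800 * (kq * (s0 * Δ * n)) + 76 * (s0 * Δ * n) - Δ * n := by ring
      have d3 : s0 * (Δ * arrHiQ3 κ Φ t p D g f mk 0 - Mm) = s0 * (Δ * arrHiQ3 κ Φ t p D g f mk 0) - s0 * Mm := by ring
      rw [d2, d3]
      linarith
    have e1 : 40 * kq * s0 * (Δ * arrHiQ3 κ Φ t p D g f mk 0 - Mm) = 40 * kq * (s0 * (Δ * arrHiQ3 κ Φ t p D g f mk 0 - Mm)) := by ring
    have e2 : 40 * kq * Δ * (n * (20 * (40 * kq * s0) + 76 * s0 - 1)) = 40 * kq * (Δ * (n * (20 * (40 * kq * s0) + 76 * s0 - 1))) := by ring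
    rw [e1, e2]
    exact mul_lt_mul_of_pos_left key (by positivity)
  · refine Skelφ.rdHi_zero_leK (hn := hn1) (hD := hDp) (hm := hm) (hc₀ := hc₀) (hkq := hkq) (hsc0 := hsc0) ?_
    rw [hr0, hKq]
    have key : s0 * (Δ * arrHiQ3 κ Φ t p D g f mk 0 - Mm) < Δ * (n * (22 * (40 * kq * s0))) := by
      have d2 : Δ * (n * (22 * (40 * kq * s0))) = 880 * (kq * (s0 * Δ * n)) := by ring
      have d3 : s0 * (Δ * arrHiQ3 κ Φ t p D g f mk 0 - Mm) = s0 * (Δ * arrHiQ3 κ Φ t p D g f mk 0) - s0 * Mm := by ring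
      rw [d2, d3]
      linarith
    have e1 : 40 * kq * s0 * (Δ * arrHiQ3 κ Φ t p D g f mk 0 - Mm) = 40 * kq * (s0 * (Δ * arrHiQ3 κ Φ t p D g f mk 0 - Mm)) := by ring
    have e2 : 40 * kq * Δ * (n * (22 * (40 * kq * s0))) = 40 * kq * (Δ * (n * (22 * (40 * kq * s0)))) := by ring
    rw [e1, e2]
    exact mul_lt_mul_of_pos_left key (by positivity)

/-- **p3-g16's first-axis root rows at the values** (SkelFrm1RootHoldsQC `hnR`, `hrow`): `R′0 ≤ n_L` and
`q + (N+1)·R′0 + (m₁+1)·(R′0 + 0 + |v_L|) + n_L ≤ (N+1)·n_L` (the left side is `X₂ + n_L ≤ 72·n_L`, and `(N+1)·n_L ≥ 20K·n_L − 146·n_L − 4R′0` by the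
centring). [this work] -/
theorem hrow_Q3 (hN : EqNumL κ Φ t p D g f) (hg : gFloorKG κ Φ t p D mk ≤ g) (hg2 : 40 * Neg.K κ * KS0.R'0 κ Φ t p D mk ≤ g) :
    KS0.R'0 κ Φ t p D mk ≤ nL κ Φ t p D g f ∧
    ((kgq κ Φ t p D g f (qxQ4 κ Φ t p D g f) : ℕ) : ℤ) +
        (((kgNv0 κ Φ t p D g f mk (qxQ4 κ Φ t p D g f) (WxQ4 κ Φ t p D g f) : ℕ) : ℤ) + 1) * ((KS0.R'0 κ Φ t p D mk : ℕ) : ℤ) +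
        ((((kgM₁ (nL κ Φ t p D g f) (ℓL κ Φ t p D g f) (hL κ Φ t p D g f) (kgR κ Φ t p D mk) 0 (kgW κ Φ t p D g f (WxQ4 κ Φ t p D g f))
          (kgNv0 κ Φ t p D g f mk (qxQ4 κ Φ t p D g f) (WxQ4 κ Φ t p D g f)) : ℕ) : ℤ)) + 1) *
          (((KS0.R'0 κ Φ t p D mk : ℕ) : ℤ) + ((0 : ℕ) : ℤ) + |vL κ Φ t p D g f|) + (nL κ Φ t p D g f : ℤ) ≤
      (((kgNv0 κ Φ t p D g f mk (qxQ4 κ Φ t p D g f) (WxQ4 κ Φ t p D g f) : ℕ) : ℤ) + 1) * (nL κ Φ t p D g f : ℤ) := by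
  have H := kgRows0_of κ Φ t p D g f mk (qxQ4 κ Φ t p D g f) (WxQ4 κ Φ t p D g f) hN hg
  obtain ⟨hn40, -, -, hR1, hK, h8⟩ := valsQ_floor κ Φ t p D g f mk hN hg hg2
  have hX₂ := X₂Q4_le κ Φ t p D g f mk hN hg hg2
  obtain ⟨-, -, hS₂, -, -⟩ := kg_floors κ Φ t p D g f mk (WxQ4 κ Φ t p D g f) hN hg (kgRes3_Q4 κ Φ t p D g f hN).hWx
  have hX := H.kgX_budget hS₂ (kgNv0 κ Φ t p D g f mk (qxQ4 κ Φ t p D g f) (WxQ4 κ Φ t p D g f))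
  obtain ⟨-, -, hlo0, -⟩ := arr_bounds3 κ Φ t p D g f mk hN hg hg2
  have e0l : arrLoQ3 κ Φ t p D g f mk 0 = (((kgNv0 κ Φ t p D g f mk (qxQ4 κ Φ t p D g f) (WxQ4 κ Φ t p D g f) : ℕ) : ℤ) + 1) * (nL κ Φ t p D g f : ℤ) +
      kgX (nL κ Φ t p D g f) (ℓL κ Φ t p D g f) (hL κ Φ t p D g f) (vL κ Φ t p D g f) (kgR κ Φ t p D mk) 0 (kgq κ Φ t p D g f (qxQ4 κ Φ t p D g f))
        (kgW κ Φ t p D g f (WxQ4 κ Φ t p D g f)) (kgNv0 κ Φ t p D g f mk (qxQ4 κ Φ t p D g f) (WxQ4 κ Φ t p D g f)) -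
        ((nL κ Φ t p D g f : ℤ) + ((0 : ℕ) : ℤ) - 1) := rfl
  have eX₂ : kgX₂ (nL κ Φ t p D g f) (ℓL κ Φ t p D g f) (hL κ Φ t p D g f) (vL κ Φ t p D g f) (kgR κ Φ t p D mk) 0 (kgq κ Φ t p D g f (qxQ4 κ Φ t p D g f))
      (kgW κ Φ t p D g f (WxQ4 κ Φ t p D g f)) (kgNv0 κ Φ t p D g f mk (qxQ4 κ Φ t p D g f) (WxQ4 κ Φ t p D g f)) =
      ((kgq κ Φ t p D g f (qxQ4 κ Φ t p D g f) : ℕ) : ℤ) +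
        (((kgNv0 κ Φ t p D g f mk (qxQ4 κ Φ t p D g f) (WxQ4 κ Φ t p D g f) : ℕ) : ℤ) + 1) * ((KS0.R'0 κ Φ t p D mk : ℕ) : ℤ) +
        ((((kgM₁ (nL κ Φ t p D g f) (ℓL κ Φ t p D g f) (hL κ Φ t p D g f) (kgR κ Φ t p D mk) 0 (kgW κ Φ t p D g f (WxQ4 κ Φ t p D g f))
          (kgNv0 κ Φ t p D g f mk (qxQ4 κ Φ t p D g f) (WxQ4 κ Φ t p D g f)) : ℕ) : ℤ)) + 1) *
          (((KS0.R'0 κ Φ t p D mk : ℕ) : ℤ) + ((0 : ℕ) : ℤ) + |vL κ Φ t p D g f|) := rfl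
  rw [e0l] at hlo0
  have eR' : kgR κ Φ t p D mk = KS0.R'0 κ Φ t p D mk := rfl
  constructor
  · have : ((KS0.R'0 κ Φ t p D mk : ℕ) : ℤ) ≤ (nL κ Φ t p D g f : ℤ) := by linarith
    exact_mod_cast this
  · rw [← eX₂]
    simp only [eR'] at hX hlo0 hX₂ ⊢
    have hn0 : (0 : ℤ) ≤ (nL κ Φ t p D g f : ℤ) := by positivity
    have hKn : 40 * (40 * (nL κ Φ t p D g f : ℤ)) ≤ 40 * (Neg.K κ : ℤ) * (nL κ Φ t p D g f : ℤ) := by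
      have := mul_le_mul_of_nonneg_right hK hn0; linarith
    push_cast at hlo0 hX ⊢
    linarith

end Arrival

end NegB

end PlanarSkeletonFrm

end Summit.CriticalPhenomena.PercolationContinuityZ3.Theorems.Transplant

end
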